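import Summits.FinalStateConjecture.FinalStateConjecture.Theses.ZeroEnergyKerrOrBomb
import Summits.FinalStateConjecture.FinalStateConjecture.Theorems.ZeroEnergyRigidity.Negative.KerrParameterSign
import Summits.FinalStateConjecture.FinalStateConjecture.Theorems.ZeroEnergyRigidity.Negative.KillingNonvanishingOfGH
import Summits.FinalStateConjecture.FinalStateConjecture.Theorems.ZeroEnergyRigidity.Negative.HorizonKillingScaling
import Literature.Geometry.Lorentzian.AxisymmetricBlackHoleUniqueness
import Literature.Geometry.Lorentzian.CausalityOpennessProofs
import Literature.Geometry.Lorentzian.LorentzianMetricProofs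

/-!
# Crux `ZeroEnergyRigidity` (stmt-FinalStateConjecture-10690) — line `global-horizon-killing-field`

Lead's skeleton (prover-line-stmt-FinalStateConjecture-10690-0, 2026-08-16), reshaped from the
planner's `Cruxes/ZeroEnergyRigidity/Lines/global-horizon-killing-field.lean`:

* every stub statement is written over TREE vocabulary only (no skeleton-local definition occurs
  in a stub type), so that each stub can be restated verbatim and landed in its own
  `Theorems/ZeroEnergyKerrOrBombZeroEnergyRigidityStub*.lean` file;
* `stub_regularRepresentation` (S1, the lead's) now also delivers what the two endgame stubs
  consume and what every carved presentation's full Kerr chart has: an h3-witness `K'` of the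
  re-presentation which is COMPLETE on the carrier and COMMUTES with `T'` (Disproof F7(ii): neither
  is derivable for an arbitrary `I⁺`-regular presentation, so they are produced by the
  re-presentation, not assumed of the input);
* `stub_rotatingUniqueness` (S3) correspondingly assumes a complete, `T`-commuting, global second
  Killing field — so that its proof is literally "Beig–Chruściel periodic combination with axis ⇒
  `IsStationaryAxisymmetric` ⇒ `ChruscielCostaHeusler2012_axisymmetricUniqueness`" with NO
  doc-localisation of the vendored theorem.

TYPING LEVER (card global-horizon-killing-field; Disproof F3): hypothesis h3
`IsNonDegenerateHorizon` of the typed crux hands out a Killing field on the WHOLE carrier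
null-generating `𝓔⁺` with `κ ≠ 0`.  As typed (Disproof F2/F8) h6 is void under h4 and h5 follows
from h4, so the crux is `CoreRigidityGH`; h5, h6 are not used below.

Composition: S1 re-presents `𝓑` by an `I⁺`-regular vacuum `𝓑'` with connected non-degenerate
horizon, complete commuting witness `K'`, and `doc' ≅ doc`; dichotomy `K' ∈ ℝT'` (S2:
non-rotating ⇒ static ⇒ Schwarzschild, CCH12 §3.3.1 + Thm 3.1) / `K' ∉ ℝT'` (S3: two Killing
fields ⇒ axisymmetric ⇒ Kerr, Beig–Chruściel + CCH12 Thm 3.2) gives the vendored conclusion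
`IsIsometricToKerrExterior` for `𝓑'`; S4 converts it to the fact-free immersion form; S5 transports
it along the d.o.c. isometry to `𝓑`.  `ZeroEnergyRigidity_of` concludes the route decl BY NAME;
`sorry` occurs only in the five `stub_*`.
-/

noncomputable section

-- `Summit.FinalStateConjecture.FinalStateConjecture.…`: summit = problem name (single-conjunct summit, D-0017).
set_option linter.dupNamespace false

namespace Summit.FinalStateConjecture.FinalStateConjecture.Theorems.ZeroEnergyRigidity.GlobalHorizonKillingField

open Set Function Literature.Geometry.Lorentzian
open scoped Manifold ContDiff Topology
open Summit.FinalStateConjecture.FinalStateConjecture.Theses.ZeroEnergyKerrOrBomb (ZeroEnergyRigidity)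

/-! ## Discharged prelude facts -/

section Prelude

variable (𝓑 : StationaryAFBlackHole.{0})

/-- `I⁺(S)` is open on the (boundaryless) carrier: the prelude fact `hF`, discharged
(O'Neill 1983, Lemma 14.3, proved in the tree). -/
theorem hF_holds : 𝓑.metric.isOpen_chronologicalFuture 𝓑.timeOrientation :=
  LorentzianMetric.isOpen_chronologicalFuture_holds_of_boundaryless

/-- `I⁻(S)` is open on the (boundaryless) carrier: the prelude fact `hP`, discharged. -/
theorem hP_holds : 𝓑.metric.isOpen_chronologicalPast 𝓑.timeOrientation :=
  LorentzianMetric.isOpen_chronologicalPast_holds_of_boundaryless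

/-- Restrictions of smooth bilinear sections to open sets are smooth: the prelude fact `hres`,
discharged. -/
theorem hres_holds :
    PseudoRiemannianMetric.contMDiff_restrict (I := 𝓡 4) (n := (∞ : ℕ∞ω)) (M := 𝓑.carrier) :=
  PseudoRiemannianMetric.contMDiff_restrict_holds

/-- The conclusion of the crux for the presentation `𝓑` (fact-free chart form), verbatim:
the d.o.c. is the image of an injective isometric immersion of a sub-extremal Kerr exterior. -/
def KerrConclusion [Kerr.Facts] : Prop :=
  ∃ (M a : ℝ), Kerr.IsSubextremal M a ∧ ∃ Ψ : Kerr.exterior M a → 𝓑.carrier,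
    Function.Injective Ψ ∧ Set.range Ψ = 𝓑.doc ∧
      PseudoRiemannianMetric.IsIsometricImmersion
        (Kerr.smoothMetric M a (Kerr.rPlus M a)).toPseudoRiemannianMetric
        𝓑.metric.toPseudoRiemannianMetric Ψ

end Prelude

/-! ## The five stubs (`sorry` lives only here; statements over tree vocabulary only) -/

/-- **Stub S1 · regularRepresentation (HARDEST; the lead holds it; the non-classical content of
the typed crux).**  A vacuum presentation with connected non-degenerate horizon (global
h3-witness) and globally hyperbolic carrier admits an `I⁺`-REGULAR vacuum re-presentation `𝓑'`
(Chruściel–Costa Def. 1.1) with connected horizon, carrying a Killing field `K'` which is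
COMPLETE, COMMUTES with the stationary field `T'`, is nowhere zero on and tangent to `𝓔⁺'` and
satisfies `∇_{K'} K' = κ K'` there with `κ ≠ 0`, and whose d.o.c. (open submanifold, restricted
metric) is carried by a smooth injective isometric immersion `Θ` onto `𝓑.doc`.  NOT "𝓑 itself is
`I⁺`-regular / has complete `K`" (both false: Disproof F7(i),(ii)) — every carved Kerr
presentation re-presents to the full black-hole chart, where `K' = ∂_{t*} + Ω_H ∂_φ` is complete
and commutes with `∂_{t*}`.  Modulo S2–S5 this statement is EQUIVALENT to the typed crux. -/
theorem stub_regularRepresentation :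
    ∀ (𝓑 : StationaryAFBlackHole.{0}) [𝓑.metric.HasLeviCivita],
      𝓑.metric.toPseudoRiemannianMetric.IsRicciFlat → IsConnected 𝓑.horizon →
      𝓑.toSpacetime.IsNonDegenerateHorizon 𝓑.Mext →
      𝓑.metric.IsGloballyHyperbolic 𝓑.timeOrientation →
        ∃ (𝓑' : StationaryAFBlackHole.{0}) (_ : 𝓑'.metric.HasLeviCivita),
          𝓑'.metric.toPseudoRiemannianMetric.IsRicciFlat ∧ 𝓑'.IsIPlusRegular ∧
          IsConnected 𝓑'.horizon ∧
          (∃ K' : Π x : 𝓑'.carrier, TangentSpace (𝓡 4) x,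
            𝓑'.metric.IsKillingField K' ∧ IsCompleteVectorField K' ∧
            (∀ x, VectorField.mlieBracket (𝓡 4) 𝓑'.killing K' x = 0) ∧
            (∀ p ∈ 𝓑'.horizon, K' p ≠ 0) ∧
            (∀ γ : ℝ → 𝓑'.carrier, IsMIntegralCurve γ K' → γ 0 ∈ 𝓑'.horizon →
              ∀ t, γ t ∈ 𝓑'.horizon) ∧
            ∃ κ : ℝ, κ ≠ 0 ∧ ∀ p ∈ 𝓑'.horizon, 𝓑'.metric.leviCivita K' p (K' p) = κ • K' p) ∧
          ∃ Θ : 𝓑'.docOpens LorentzianMetric.isOpen_chronologicalFuture_holds_of_boundaryless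
              LorentzianMetric.isOpen_chronologicalPast_holds_of_boundaryless → 𝓑.carrier,
            Function.Injective Θ ∧ Set.range Θ = 𝓑.doc ∧
            PseudoRiemannianMetric.IsIsometricImmersion
              (𝓑'.metric.restrict PseudoRiemannianMetric.contMDiff_restrict_holds
                (𝓑'.docOpens LorentzianMetric.isOpen_chronologicalFuture_holds_of_boundaryless
                  LorentzianMetric.isOpen_chronologicalPast_holds_of_boundaryless)).toPseudoRiemannianMetric
              𝓑.metric.toPseudoRiemannianMetric Θ := by
  sorry

/-- **Stub S2 · nonRotatingUniqueness** (Alexakis–Ionescu–Klainerman schema at the predicate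
"`I⁺`-regular, connected non-degenerate horizon, NON-ROTATING": some non-zero constant multiple of
the stationary field `T` is an h3-witness).  Printed chain: Sudarsky–Wald 1993 staticity via the
Chruściel–Wald 1994 maximal hypersurface (this is where `I⁺`-regularity enters), then the static
classification without analyticity (Chruściel–Costa–Heusler 2012 Thm 3.1 = Chruściel–Galloway
2010 Thm 1.1/4.1) gives a Schwarzschild exterior with `M > 0` (non-empty horizon), a sub-extremal
Kerr exterior with `a = 0` (`IsIsometricToSchwarzschildExterior.isIsometricToKerrExterior`).
CCH12 arXiv:1205.6112 §3.3.1.  Size XL (known; SW93/CW94 un-vendored). -/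
theorem stub_nonRotatingUniqueness :
    AlexakisIonescuKlainermanRigidity.{0} fun 𝓑 ↦ 𝓑.IsIPlusRegularNonDegenerate ∧
      ∀ [𝓑.metric.HasLeviCivita], ∃ c : ℝ, c ≠ 0 ∧ 𝓑.metric.IsKillingField (c • 𝓑.killing) ∧
        (∀ p ∈ 𝓑.horizon, (c • 𝓑.killing) p ≠ 0) ∧
        (∀ γ : ℝ → 𝓑.carrier, IsMIntegralCurve γ (c • 𝓑.killing) → γ 0 ∈ 𝓑.horizon →
          ∀ t, γ t ∈ 𝓑.horizon) ∧
        ∃ κ : ℝ, κ ≠ 0 ∧ ∀ p ∈ 𝓑.horizon,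
          𝓑.metric.leviCivita (c • 𝓑.killing) p ((c • 𝓑.killing) p) = κ • (c • 𝓑.killing) p := by
  sorry

/-- **Stub S3 · rotatingUniqueness** (AIK schema at "`I⁺`-regular, connected horizon, a COMPLETE
global second Killing field `K` commuting with `T`, null-generating `𝓔⁺` with `κ ≠ 0`, not a
constant multiple of `T`").  Printed chain: Beig–Chruściel (CMP 188 (1997) Thm 1.2, JMP 37
(1996)): the Killing algebra of an AF stationary vacuum end with timelike ADM momentum (positive
mass for black holes on the `I⁺`-regular hypersurface, GHHP 1983 / Herzlich 1998) is `ℝT ⊕ 𝔰`,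
`𝔰 ⊆ so(3)`, so some combination `Y = aT + bK` (complete: `T`, `K` complete and commuting) has
`2π`-periodic orbits and an axis, `[T, Y] = 0` — i.e. `𝓑.IsStationaryAxisymmetric` — and then the
vendored `ChruscielCostaHeusler2012_axisymmetricUniqueness` (CCH12 Thm 3.2) gives the Kerr
exterior.  Size XL (known modulo vendoring BC96/97). -/
theorem stub_rotatingUniqueness :
    AlexakisIonescuKlainermanRigidity.{0} fun 𝓑 ↦ 𝓑.IsIPlusRegular ∧ IsConnected 𝓑.horizon ∧
      ∀ [𝓑.metric.HasLeviCivita], ∃ K : Π x : 𝓑.carrier, TangentSpace (𝓡 4) x,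
        𝓑.metric.IsKillingField K ∧ IsCompleteVectorField K ∧
        (∀ x, VectorField.mlieBracket (𝓡 4) 𝓑.killing K x = 0) ∧
        (∀ p ∈ 𝓑.horizon, K p ≠ 0) ∧
        (∀ γ : ℝ → 𝓑.carrier, IsMIntegralCurve γ K → γ 0 ∈ 𝓑.horizon → ∀ t, γ t ∈ 𝓑.horizon) ∧
        (∃ κ : ℝ, κ ≠ 0 ∧ ∀ p ∈ 𝓑.horizon, 𝓑.metric.leviCivita K p (K p) = κ • K p) ∧
        ¬ ∃ c : ℝ, K = c • 𝓑.killing := by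
  sorry

/-- **Stub S4 · kerrChartTransfer**: the vendored conclusion `IsIsometricToKerrExterior hF hP hres`
(a `Diffeomorph` `Φ` of the open submanifold `⟨⟨M_ext⟩⟩` onto `Kerr.exterior M a`, an isometry of
the restricted metric), taken at the DISCHARGED prelude facts (`hF hP` := O'Neill 14.3 proved for
boundaryless carriers, `hres := contMDiff_restrict_holds`; by proof irrelevance this is the general
case), yields the fact-free chart form of the crux conclusion (`Ψ := Subtype.val ∘ Φ.symm`:
injective, range `= doc`, isometric immersion by functoriality of `pullbackBilin` and
`val_restrict`).  Size M, provable now. -/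
theorem stub_kerrChartTransfer :
    ∀ (𝓑 : StationaryAFBlackHole.{0}) [Kerr.Facts],
      𝓑.IsIsometricToKerrExterior LorentzianMetric.isOpen_chronologicalFuture_holds_of_boundaryless
          LorentzianMetric.isOpen_chronologicalPast_holds_of_boundaryless
          PseudoRiemannianMetric.contMDiff_restrict_holds →
        ∃ (M a : ℝ), Kerr.IsSubextremal M a ∧ ∃ Ψ : Kerr.exterior M a → 𝓑.carrier,
          Function.Injective Ψ ∧ Set.range Ψ = 𝓑.doc ∧
            PseudoRiemannianMetric.IsIsometricImmersion
              (Kerr.smoothMetric M a (Kerr.rPlus M a)).toPseudoRiemannianMetric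
              𝓑.metric.toPseudoRiemannianMetric Ψ := by
  sorry

/-- **Stub S5 · docIsometryTransfer**: if the open submanifold `⟨⟨M_ext'⟩⟩ ⊆ 𝓑'` (restricted metric)
is carried by a smooth injective isometric immersion `Θ` onto `𝓑.doc`, and `𝓑'` satisfies the
fact-free Kerr conclusion, so does `𝓑` (corestrict `Ψ' : Kerr.exterior → 𝓑'` to the open
submanifold `⟨⟨M_ext'⟩⟩ = range Ψ'`, compose with `Θ`; isometric immersions compose).  Size M,
provable now. -/
theorem stub_docIsometryTransfer :
    ∀ (𝓑 𝓑' : StationaryAFBlackHole.{0}) [Kerr.Facts],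
      (∃ Θ : 𝓑'.docOpens LorentzianMetric.isOpen_chronologicalFuture_holds_of_boundaryless
          LorentzianMetric.isOpen_chronologicalPast_holds_of_boundaryless → 𝓑.carrier,
        Function.Injective Θ ∧ Set.range Θ = 𝓑.doc ∧
        PseudoRiemannianMetric.IsIsometricImmersion
          (𝓑'.metric.restrict PseudoRiemannianMetric.contMDiff_restrict_holds
            (𝓑'.docOpens LorentzianMetric.isOpen_chronologicalFuture_holds_of_boundaryless
              LorentzianMetric.isOpen_chronologicalPast_holds_of_boundaryless)).toPseudoRiemannianMetric
          𝓑.metric.toPseudoRiemannianMetric Θ) →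
      (∃ (M a : ℝ), Kerr.IsSubextremal M a ∧ ∃ Ψ : Kerr.exterior M a → 𝓑'.carrier,
        Function.Injective Ψ ∧ Set.range Ψ = 𝓑'.doc ∧
          PseudoRiemannianMetric.IsIsometricImmersion
            (Kerr.smoothMetric M a (Kerr.rPlus M a)).toPseudoRiemannianMetric
            𝓑'.metric.toPseudoRiemannianMetric Ψ) →
      ∃ (M a : ℝ), Kerr.IsSubextremal M a ∧ ∃ Ψ : Kerr.exterior M a → 𝓑.carrier,
        Function.Injective Ψ ∧ Set.range Ψ = 𝓑.doc ∧
          PseudoRiemannianMetric.IsIsometricImmersion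
            (Kerr.smoothMetric M a (Kerr.rPlus M a)).toPseudoRiemannianMetric
            𝓑.metric.toPseudoRiemannianMetric Ψ := by
  sorry

/-! ## Composition (kernel-checked, no `sorry` outside the stubs) -/

/-- A vector field vanishing nowhere on a non-empty set is not the ZERO multiple of `T`. -/
lemma ne_zero_of_eq_smul {𝓑 : StationaryAFBlackHole.{0}} {c : ℝ}
    (hne : ∀ p ∈ 𝓑.horizon, (c • 𝓑.killing) p ≠ 0) (hH : 𝓑.horizon.Nonempty) : c ≠ 0 := by
  rintro rfl
  obtain ⟨p, hp⟩ := hH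
  exact hne p hp (by simp)

/-- **The dichotomy endgame on an `I⁺`-regular presentation**: S2–S4 give the fact-free Kerr
conclusion for every `I⁺`-regular vacuum presentation with connected horizon carrying a complete,
`T`-commuting h3-witness `K`, by cases on `K ∈ ℝT`. -/
theorem kerrConclusion_of_regular (𝓑 : StationaryAFBlackHole.{0}) [𝓑.metric.HasLeviCivita]
    [Kerr.Facts] (h1 : 𝓑.metric.toPseudoRiemannianMetric.IsRicciFlat) (hreg : 𝓑.IsIPlusRegular)
    (hconn : IsConnected 𝓑.horizon) (K : Π x : 𝓑.carrier, TangentSpace (𝓡 4) x)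
    (hK : 𝓑.metric.IsKillingField K) (hKc : IsCompleteVectorField K)
    (hcomm : ∀ x, VectorField.mlieBracket (𝓡 4) 𝓑.killing K x = 0)
    (hne : ∀ p ∈ 𝓑.horizon, K p ≠ 0)
    (htan : ∀ γ : ℝ → 𝓑.carrier, IsMIntegralCurve γ K → γ 0 ∈ 𝓑.horizon → ∀ t, γ t ∈ 𝓑.horizon)
    (hκ : ∃ κ : ℝ, κ ≠ 0 ∧ ∀ p ∈ 𝓑.horizon, 𝓑.metric.leviCivita K p (K p) = κ • K p) :
    KerrConclusion 𝓑 := by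
  classical
  by_cases hrot : ∃ c : ℝ, K = c • 𝓑.killing
  · -- non-rotating branch: K = c • T with c ≠ 0
    obtain ⟨c, rfl⟩ := hrot
    have hc : c ≠ 0 := ne_zero_of_eq_smul hne hconn.nonempty
    exact stub_kerrChartTransfer 𝓑
      (stub_nonRotatingUniqueness 𝓑 (hF_holds 𝓑) (hP_holds 𝓑) (hres_holds 𝓑)
        ⟨⟨hreg, hconn, fun {_} ↦ ⟨c • 𝓑.killing, hK, hne, htan, hκ⟩⟩,
          fun {_} ↦ ⟨c, hc, hK, hne, htan, hκ⟩⟩ h1)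
  · -- rotating branch: T and K independent Killing fields
    exact stub_kerrChartTransfer 𝓑
      (stub_rotatingUniqueness 𝓑 (hF_holds 𝓑) (hP_holds 𝓑) (hres_holds 𝓑)
        ⟨hreg, hconn, fun {_} ↦ ⟨K, hK, hKc, hcomm, hne, htan, hκ, hrot⟩⟩ h1)

/-- **The skeleton theorem**: the five stubs imply the crux `ZeroEnergyRigidity` BY NAME.
Hypotheses h5 (`T ≠ 0` on the d.o.c.) and h6 (no imprisoned zero-energy ray) are not used
(Disproof F8/F2: both are theorems under h4). -/
theorem ZeroEnergyRigidity_of : ZeroEnergyRigidity := by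
  intro 𝓑 _ _ h1 h2 h3 h4 _h5 _h6
  obtain ⟨𝓑', inst', h1', hreg', hconn', ⟨K', hK', hKc', hcomm', hne', htan', hκ'⟩, hΘ⟩ :=
    stub_regularRepresentation 𝓑 h1 h2 h3 h4
  haveI := inst'
  exact stub_docIsometryTransfer 𝓑 𝓑' hΘ
    (kerrConclusion_of_regular 𝓑' h1' hreg' hconn' K' hK' hKc' hcomm' hne' htan' hκ')

end Summit.FinalStateConjecture.FinalStateConjecture.Theorems.ZeroEnergyRigidity.GlobalHorizonKillingField

end
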